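import Summits.CriticalPhenomena.CardyFormulaZ2.Theorems.CardyIKTransportIKLinearTransportWallDominationDefs

/-!
# `CardyIKTransport.IKLinearTransport` (stmt-CriticalPhenomena-5076, line `pinned-diagram-exchange`, lead c8 wave 1) —
# WALL DOMINATION: the registered sub-goal `stub_rotInvariance` (the rotation by `π` of the cylinder slab)

Support file (`--supports stmt-CriticalPhenomena-5076`), sorry-free.

`stub_rotInvariance : RotInvariance` — the rotation `rotCyl` of a slab configuration (cell `(i, r) ↦ (w - i, -r)`,
face `(j, r) ↦ (w - 1 - j, -r - 1)`, `…WallDominationDefs` §4):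
* (i) is an involution (`Fin.rev_rev`, `-(-r - 1) - 1 = r`);
* (ii) preserves the slab weight with the face types reversed: the four corners of the face `(j, r)` are mapped to
  the four corners of the face `(rev j, -r - 1)` (`Fin.rev_castSucc`, `Fin.rev_succ`), so the parity of the rotated
  configuration at `(j, r)` is the parity of the original one at `(rev j, -r - 1)` (`cylFaceOdd_rotCyl`), the flag
  is read there by definition, and the product over the faces is re-indexed along the involution
  `(j, r) ↦ (rev j, -r - 1)` (`Fintype.prod_equiv`);
* (iii) transports black connectivity: an oriented edge `u → v` of the slab triangulation of the rotated flags is an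
  oriented edge `rot v → rot u` of the triangulation of the original flags (`rel_rot`: vertical and horizontal steps
  are reversed, the main diagonal of the face `(j, r)` of the rotated flags is the main diagonal of the face
  `(rev j, -r - 1)` of the original ones, the anti-diagonal its anti-diagonal), so `rot` is a homomorphism of the
  monochromatic triangulations (`SlabDetStub.blackConn_iff`, `monoGraph_adj`, `SimpleGraph.Reachable.map`); the
  converse is the same statement for `rotCyl x` and (i);
* (iv) hence preserves slab probabilities (numerator and partition function re-indexed along `rotCyl`,
  `Fintype.sum_equiv`);
* (v) turns last-wall-monotone events into wall-monotone ones (`Fin.rev_last`: the wall is mapped onto the last cell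
  column, and by (iii) the wall profile of `x` at `(-r, -s)` is the last-column profile of `rotCyl x` at `(r, s)`).
-/

noncomputable section

namespace Summit.CriticalPhenomena.CardyFormulaZ2.Theorems.IKLinearTransport.PinnedDiagramExchange.WallDomination

open scoped BigOperators Classical
open Finset
open Summit.CriticalPhenomena.CardyFormulaZ2.Cruxes.IKMixedBoxCrossing.DefectClosureExploration
open CylBunchStub (resLE resLast splitEquiv colConst)

namespace RotInvarianceStub

variable {w L : ℕ}

/-! ## (i) The rotation is an involution -/

/-- `rotCyl` is an involution. -/
theorem rotCyl_rotCyl (x : CylCfg w L) : rotCyl (rotCyl x) = x := by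
  refine Prod.ext (funext fun c => ?_) (funext fun f => ?_)
  · obtain ⟨i, r⟩ := c
    show x.1 (Fin.rev (Fin.rev i), -(-r)) = x.1 (i, r)
    rw [Fin.rev_rev, neg_neg]
  · obtain ⟨j, r⟩ := f
    show x.2 (Fin.rev (Fin.rev j), -(-r - 1) - 1) = x.2 (j, r)
    rw [Fin.rev_rev, show -(-r - 1) - 1 = r by ring]

/-- `rotCyl` as an involutive self-map of the slab configurations. -/
theorem rotCyl_involutive : Function.Involutive (rotCyl : CylCfg w L → CylCfg w L) := rotCyl_rotCyl

/-! ## (ii) Face parities and the slab weight -/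

/-- The corner permutation induced by the rotation preserves the parity of a face. -/
theorem xor_rot : ∀ a b c d : Bool, ((a ^^ b) ^^ (c ^^ d)) = ((d ^^ c) ^^ (b ^^ a)) := by decide

/-- The parity of the rotated configuration at the face `(j, r)` is the parity of the original configuration at the
image face `(rev j, -r - 1)` (the four corners are permuted). -/
theorem cylFaceOdd_rotCyl (x : CylCfg w L) (f : Fin w × ZMod L) :
    cylFaceOdd (rotCyl x).1 f = cylFaceOdd x.1 (Fin.rev f.1, -f.2 - 1) := by
  have e1 : -(f.2 + 1) = -f.2 - 1 := by ring
  have e2 : -f.2 - 1 + 1 = -f.2 := by ring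
  simp only [cylFaceOdd, rotCyl, Fin.rev_castSucc, Fin.rev_succ, e1, e2]
  exact xor_rot _ _ _ _

/-- The face map of the rotation, `(j, r) ↦ (rev j, -r - 1)`, is an involution of `Fin w × ZMod L`. -/
theorem faceRot_involutive :
    Function.Involutive (fun f : Fin w × ZMod L => ((Fin.rev f.1, -f.2 - 1) : Fin w × ZMod L)) := by
  rintro ⟨j, r⟩
  show ((Fin.rev (Fin.rev j), -(-r - 1) - 1) : Fin w × ZMod L) = (j, r)
  rw [Fin.rev_rev, show -(-r - 1) - 1 = r by ring]

/-- (ii) The slab weight is preserved by the rotation, with the face types reversed. -/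
theorem cylWeight_rotCyl [NeZero L] (τ : Fin w → Bool) (x : CylCfg w L) :
    cylWeight w L (τ ∘ Fin.rev) (rotCyl x) = cylWeight w L τ x := by
  unfold cylWeight
  refine Fintype.prod_equiv (Function.Involutive.toPerm _ faceRot_involutive) _ _ fun f => ?_
  rw [cylFaceOdd_rotCyl]
  rfl

/-! ## (iii) Black connectivity -/

/-- ONE ORIENTED EDGE `u → v` of the slab triangulation of the ROTATED flags is an oriented edge from the image of `v`
to the image of `u` in the triangulation of the original flags (the rotation reverses the orientation; the diagonal
of a face goes to the diagonal of the same kind of the image face). -/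
theorem rel_rot (x : CylCfg w L) {u v : Fin (w + 1) × ZMod L}
    (h : (v.1 = u.1 ∧ v.2 = u.2 + 1) ∨ (v.1.val = u.1.val + 1 ∧ v.2 = u.2) ∨
      (∃ j : Fin w, u.1 = j.castSucc ∧ v.1 = j.succ ∧ v.2 = u.2 + 1 ∧ (rotCyl x).2 (j, u.2) = false) ∨
      (∃ j : Fin w, u.1 = j.castSucc ∧ v.1 = j.succ ∧ u.2 = v.2 + 1 ∧ (rotCyl x).2 (j, v.2) = true)) :
    ((Fin.rev u.1 : Fin (w + 1)) = Fin.rev v.1 ∧ -u.2 = -v.2 + 1) ∨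
      ((Fin.rev u.1 : Fin (w + 1)).val = (Fin.rev v.1 : Fin (w + 1)).val + 1 ∧ -u.2 = -v.2) ∨
      (∃ j : Fin w, Fin.rev v.1 = j.castSucc ∧ Fin.rev u.1 = j.succ ∧ -u.2 = -v.2 + 1 ∧
        x.2 (j, -v.2) = false) ∨
      (∃ j : Fin w, Fin.rev v.1 = j.castSucc ∧ Fin.rev u.1 = j.succ ∧ -v.2 = -u.2 + 1 ∧
        x.2 (j, -u.2) = true) := by
  rcases h with ⟨h1, h2⟩ | ⟨h1, h2⟩ | ⟨j, h1, h2, h3, h4⟩ | ⟨j, h1, h2, h3, h4⟩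
  · exact Or.inl ⟨by rw [h1], by rw [h2]; ring⟩
  · refine Or.inr (Or.inl ⟨?_, by rw [h2]⟩)
    rw [Fin.val_rev, Fin.val_rev]
    have := v.1.isLt
    omega
  · refine Or.inr (Or.inr (Or.inl ⟨Fin.rev j, ?_, ?_, ?_, ?_⟩))
    · rw [h2, Fin.rev_succ]
    · rw [h1, Fin.rev_castSucc]
    · rw [h3]; ring
    · have h4' : x.2 (Fin.rev j, -u.2 - 1) = false := h4
      rw [h3, show -(u.2 + 1) = -u.2 - 1 by ring]
      exact h4'
  · refine Or.inr (Or.inr (Or.inr ⟨Fin.rev j, ?_, ?_, ?_, ?_⟩))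
    · rw [h2, Fin.rev_succ]
    · rw [h1, Fin.rev_castSucc]
    · rw [h3]; ring
    · have h4' : x.2 (Fin.rev j, -v.2 - 1) = true := h4
      rw [h3, show -(v.2 + 1) = -v.2 - 1 by ring]
      exact h4'

/-- The cell map of the rotation, `(i, r) ↦ (rev i, -r)`, is injective. -/
theorem rot_inj {u v : Fin (w + 1) × ZMod L}
    (h : ((Fin.rev u.1, -u.2) : Fin (w + 1) × ZMod L) = (Fin.rev v.1, -v.2)) : u = v := by
  simp only [Prod.mk.injEq, Fin.rev_inj, neg_inj] at h
  exact Prod.ext h.1 h.2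

/-- Adjacency in the triangulation of the rotated flags is adjacency of the images in the triangulation of the
original flags. -/
theorem adj_rot (x : CylCfg w L) {u v : Fin (w + 1) × ZMod L} (h : (cylGraph w L (rotCyl x).2).Adj u v) :
    (cylGraph w L x.2).Adj (Fin.rev u.1, -u.2) (Fin.rev v.1, -v.2) := by
  simp only [cylGraph, SimpleGraph.fromRel_adj] at h ⊢
  exact ⟨fun heq => h.1 (rot_inj heq), h.2.symm.imp (rel_rot x) (rel_rot x)⟩

/-- Monochromatic reachability is transported by the rotation (the cell map is a homomorphism of the monochromatic
triangulations). -/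
theorem reach_rot (x : CylCfg w L) {u v : Fin (w + 1) × ZMod L}
    (h : (cylGraph w L (rotCyl x).2 ⊓ monoGraph (rotCyl x).1).Reachable u v) :
    (cylGraph w L x.2 ⊓ monoGraph x.1).Reachable (Fin.rev u.1, -u.2) (Fin.rev v.1, -v.2) := by
  let φ : cylGraph w L (rotCyl x).2 ⊓ monoGraph (rotCyl x).1 →g cylGraph w L x.2 ⊓ monoGraph x.1 :=
    { toFun := fun p => (Fin.rev p.1, -p.2)
      map_rel' := fun {a b} hab => by
        rw [SimpleGraph.inf_adj, monoGraph_adj] at hab ⊢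
        exact ⟨adj_rot x hab.1, fun heq => hab.2.1 (rot_inj heq), hab.2.2⟩ }
  exact h.map φ

/-- Black connectivity in the rotated configuration gives black connectivity of the images in the original one. -/
theorem blackConn_rot_imp (x : CylCfg w L) {u v : Fin (w + 1) × ZMod L} (h : BlackConn (rotCyl x) u v) :
    BlackConn x (Fin.rev u.1, -u.2) (Fin.rev v.1, -v.2) := by
  rw [SlabDetStub.blackConn_iff] at h ⊢
  exact ⟨h.1, reach_rot x h.2⟩

/-- (iii) The rotation transports black connectivity. -/
theorem blackConn_rotCyl (x : CylCfg w L) (u v : Fin (w + 1) × ZMod L) :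
    BlackConn (rotCyl x) u v ↔ BlackConn x (Fin.rev u.1, -u.2) (Fin.rev v.1, -v.2) := by
  refine ⟨blackConn_rot_imp x, fun h => ?_⟩
  rw [← rotCyl_rotCyl x] at h
  simpa only [Fin.rev_rev, neg_neg, Prod.mk.eta] using blackConn_rot_imp (rotCyl x) h

/-! ## (iv) Slab probabilities -/

/-- The slab weight for the reversed face types is the weight of the rotated configuration for the original ones. -/
theorem cylWeight_rev [NeZero L] (τ : Fin w → Bool) (x : CylCfg w L) :
    cylWeight w L (τ ∘ Fin.rev) x = cylWeight w L τ (rotCyl x) := by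
  have h := cylWeight_rotCyl τ (rotCyl x)
  rwa [rotCyl_rotCyl] at h

/-- (iv) Slab probabilities are preserved by the rotation, with the face types reversed. -/
theorem cylProb_rotCyl [NeZero L] (τ : Fin w → Bool) (E : Set (CylCfg w L)) :
    cylProb w L (τ ∘ Fin.rev) (rotCyl ⁻¹' E) = cylProb w L τ E := by
  unfold cylProb cylZ
  congr 1
  · exact Fintype.sum_equiv (Function.Involutive.toPerm _ rotCyl_involutive) _ _ fun x => by
      rw [Function.Involutive.coe_toPerm, Set.mem_preimage, cylWeight_rev]
  · exact Fintype.sum_equiv (Function.Involutive.toPerm _ rotCyl_involutive) _ _ fun x => by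
      rw [Function.Involutive.coe_toPerm, cylWeight_rev]

/-! ## (v) Last-wall-monotone events -/

/-- (v) The preimage under the rotation of a last-wall-monotone event is wall-monotone. -/
theorem wallMonotone_preimage (E : Set (CylCfg w L)) (hE : LastWallMonotone E) :
    WallMonotone (rotCyl ⁻¹' E) := by
  intro x y hc hr hx
  refine hE (rotCyl x) (rotCyl y) (funext fun r => ?_) ?_ hx
  · show x.1 (Fin.rev (Fin.last w), -r) = y.1 (Fin.rev (Fin.last w), -r)
    rw [Fin.rev_last]
    exact congrFun hc (-r)
  · intro rs h
    simp only [Set.mem_setOf_eq, blackConn_rotCyl, Fin.rev_last] at h ⊢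
    exact hr (show ((-rs.1, -rs.2) : ZMod L × ZMod L) ∈ wallRel x from h)

end RotInvarianceStub

/-- **Registered sub-goal `stub_rotInvariance`** (`RotInvariance`): the rotation by `π` of the cylinder slab is an
involution, preserves the slab weight with the face types reversed, transports black connectivity, hence preserves
slab probabilities (types reversed) and turns last-wall-monotone events into wall-monotone ones. -/
theorem stub_rotInvariance : RotInvariance :=
  ⟨fun _ _ x => RotInvarianceStub.rotCyl_rotCyl x,
    fun _ _ _ τ x => RotInvarianceStub.cylWeight_rotCyl τ x,
    fun _ _ x u v => RotInvarianceStub.blackConn_rotCyl x u v,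
    fun _ _ _ τ E => RotInvarianceStub.cylProb_rotCyl τ E,
    fun _ _ E hE => RotInvarianceStub.wallMonotone_preimage E hE⟩

end Summit.CriticalPhenomena.CardyFormulaZ2.Theorems.IKLinearTransport.PinnedDiagramExchange.WallDomination

end
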